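import Literature.MathematicalPhysics.QuantumFieldTheory.BalabanImbrieJaffe1984to88.BIJ88Eq5613Summary

/-!
# `BalabanImbrieJaffe1984to88.BIJ88Eq5613Kinetic` — T. Bałaban, J. Imbrie, A. Jaffe, *Effective action and cluster properties of the
abelian Higgs model*, Commun. Math. Phys. **114** (1988) 257–315 [BalabanImbrieJaffe1988], §5.6 p. 288 [PDF 32]: **(5.6.13) for the
kinetic term `½aL⁻²⟨ψ − Q(u)φ, ψ − Q(u)φ⟩` at OPERATOR level** — MODEL INSTANCE of the companion bookkeeping file `BIJ88Eq5613Summary`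
on r16's covariant block average `BIJ88Sect5StatementsPart4.covAvg` (= the matrix `BIJ88Vj5610Operator.qMat` of p31 gen 10): the
`e′`-family `e′ ↦ ½aL⁻²|ψ(y) − (Q(ũ_{k+1}e^{ie′e_kηθ_kH_{k,loc}A^{(k)}})φ)(y)|²` is smooth with `n`-th derivative
`≤ |κ|(2G)ⁿρ₁(‖ψ(y)‖ + ρ₁)`, its order-`> n̄` Taylor remainder `W₁,kin(y)` and the cube terms `W₁,kin(□) = Σ_{y∈□}W₁,kin(y)` are
explicit, local, and obey *"|W₁^{(k)}(□)| ≦ e_k^{n̄−1−α}"* for small `e_k` under DISPLAYED small-field hypotheses — *"(Two powers of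
e_k may be needed to beat the bounds on φ.)"*

statement-level skeleton of published theorems with citation tags; proofs where landed; nothing here is a claim about the Yang–Mills mass gap

PDF held: `paper:balaban1988-cmp114-bij-abelian-higgs-effective-action` (journal page = PDF page + 256); p. 288 [PDF 32] and p. 287
[PDF 31] read as images this session (r16's render `renders/cmp114/original-p032-x2.png`; seat render `renders/original-p031-x2.png`),
pp. 278–279 [PDF 22–23] ((5.2.2) small-field radii) likewise.

CITATION HEADER (lean-in-tree rule).  Part of the lit-balaban TYPED SKELETON (HOME `run/shared/lean/pub/lit-balaban/`), PHASE-2 proof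
seat p31 gen 11 (unit `lit-balaban-p31-g11`; TAKING line HOME/STATUS.md 2026-08-22T02:59Z).  WHAT IS REPRODUCED: row `C2.Eq5.6.13` of
`HOME/lit-balaban-r16/ROWS-C2-part2.md` (owner r16), kind «model-instance» for the FIRST of the three action terms of (5.6.13),
p. 288 [PDF 32], verbatim: *"½aL⁻²⟨ψ̃ − Q(u′_k)φ̃, ψ̃ − Q(u′_k)φ̃⟩ + … = ½aL⁻²⟨ψ − Q(ũ_{k+1})φ, ψ − Q(ũ_{k+1})φ⟩ + … + R^{(k)}(u_{k+1},
θ_kH_{k,loc}A^{(k)}) + Σ_□ W₁^{(k)}(□). (5.6.13) The tildes on φ and ψ indicate the presence of the phase factors. Here W₁^{(k)}(□) is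
localized near □, an r(e_k)-cube in Λ₂^{(k)}, and |W₁^{(k)}(□)| ≦ e_k^{n̄−1−α}. (Two powers of e_k may be needed to beat the bounds on
φ.) If we define R̃^{(k)}(ũ_{k+1}, θ_kH_{k,loc}A^{(k)}) = Σ_{n=1}^{n̄}[dⁿ/de′ⁿ(½aL⁻²‖ψ − Q(ũ_{k+1}e^{ie′e_kηθ_kH_{k,loc}A^{(k)}})φ‖² + …)]_{e′=0},
(5.6.14) …"*; with p. 287 (5.6.8) *"Inserting this formula into |(ψ − Q(ũ_{k+1}ũ)φ)(y)|², we obtain the vertices new to this step"*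
and p. 288 *"Any term involving w₁ or w₂, and terms of higher than n̄-th order in e_k are irrelevant and will be treated separately.
… All terms are local."*

THE MECHANISM.  Along the interpolation the transporters are `U(y,x)e^{ie′A(y,x)}` (`twist U A e′`; `U(y,x) = ũ_{k+1}(Γ_{y,x})`,
`A(y,x) = e_kη·(θ_kH_{k,loc}A^{(k)})(Γ_{y,x}) ∈ ℝ` the contour sum), so the site residual `r_y(e′) = ψ(y) − (Q(Ue^{ie′A})φ)(y)`
(`resid`) is `ψ(y) − Σ_{x∈B(y)} wU(y,x)φ(x)e^{ie′A(y,x)}` — an exponential sum in `e′`: smooth, with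
`dⁿr_y/de′ⁿ = −Σ_x wU(y,x)φ(x)(iA(y,x))ⁿe^{ie′A(y,x)}` (`iteratedDeriv_resid_succ`), hence `‖dⁿr_y/de′ⁿ‖ ≤ Gⁿρ₁` for `n ≥ 1`
(`|A(y,x)| ≤ G`, `|U| ≤ 1`, `ρ₁ = |w|Σ_{x∈B(y)}‖φ(x)‖`) and `‖r_y‖ ≤ ‖ψ(y)‖ + ρ₁ =: ρ₀`.  The site density
`S_y(e′) = κ‖r_y(e′)‖²` (`kin`; `κ` = ½aL⁻² times the lattice weight of the `ψ`-site) is `κ⟪r_y, r_y⟫_ℝ`, so by the bilinear Leibniz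
bound (Mathlib `ContinuousLinearMap.norm_iteratedFDeriv_le_of_bilinear_of_le_one` for `innerSL ℝ` on `ℂ`) `|dⁿS_y/de′ⁿ| ≤
|κ|Σ_i C(n,i)‖r^{(i)}‖‖r^{(n−i)}‖ ≤ |κ|(2G)ⁿρ₁ρ₀` (`abs_iteratedDeriv_kin_le`).  The order-`> n̄` remainder `W₁,kin(y) := F̃` of
p02/the companion file then obeys `|W₁,kin(y)| ≤ |κ|(2G)^{n̄+1}ρ₁ρ₀/n̄!` (`abs_W1kin_le`), and in print's currency — `G ≤ c_G·e_k·p(e_k)`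
(each `e′`-derivative brings `ie_kηθ_kH_{k,loc}A^{(k)}(Γ)`, `|A^{(k)}| ≲ p(e_k)`, `|Γ| ≲ L^k = η⁻¹`), `e_kΦ ≤ c_Φp(e_k)`, `e_kΨ ≤ c_Ψp(e_k)`
(the (5.2.2)/(4.5) radii `O(λ_k^{−1/4}p(e_k))` with `e_k²/λ_k^{1/2} = O(1)`: *"Two powers of e_k may be needed to beat the bounds on
φ"*), `|□| ≤ r(e_k)^d` sites — `|W₁,kin(□)| ≤ K·e_k^{n̄−1}·(log e_k⁻¹)^{p(n̄+3)+rd} ≤ e_k^{n̄−1−α}` below the explicit threshold of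
`BIJ88Eq5613Summary.absorb_logs` (`abs_W1kinCube_le_scale`, **`ineq5613_kinetic`**).

WHAT IS PROVED (0 `sorry`, standard axioms; definitions with bodies + theorems, no `Prop` facts).
* §1 `ephase`/`twist`/`resid`/`kin` and the (5.6.8) links: `twist_zero` (`e′ = 0`: `Q(ũ_{k+1})`), **`covAvg_twist_one`** (`e′ = 1`:
  `Q(ũ_{k+1}e^{iA}) = Q(ũ_{k+1}) + F₂`, r16's `eq568`), `resid_zero_eq`, `kin_zero`/`kin_one`.
* §2 smoothness and derivatives: `iteratedDeriv_ephase`, `contDiff_resid`, **`iteratedDeriv_resid_succ`**, `contDiff_kin`, `iteratedDeriv_kin`.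
* §3 bounds: `norm_iteratedDeriv_resid_succ_le` (`Gⁿρ₁`), `norm_resid_le` (`ρ₀`), `choose_sum_bound` (the combinatorial step
  `Σ_iC(n,i)b_ib_{n−i} ≤ (2G)ⁿρ₁ρ₀`), **`abs_iteratedDeriv_kin_le`**.
* §4 the Taylor remainder: `W1kin` (:= p02's `Ftilde` of the site family), **`eq5613_kin_site`** (`S_y(1) = S_y(0) + R̃_y + W₁,kin(y)`),
  **`abs_W1kin_le`** (`|κ|(2G)^{n̄+1}ρ₁ρ₀/n̄!`), `abs_W1kin_le_of_fieldBounds` (`ρ₁ ≤ Φ`, `ρ₀ ≤ Ψ + Φ` from `|w||B(y)| ≤ 1`).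
* §5 sites and cubes: `W1kinCube` (`= cubeSum`), **`eq5613_kinetic`** (the kinetic line of (5.6.13): `Σ_yS_y(1) = Σ_yS_y(0) + Σ_yR̃_y +
  Σ_□W₁,kin(□)`, with `Σ_yR̃_y = R̃` of the total kinetic family `Rtilde_kinAction`), `abs_W1kinCube_le`.
* §6 locality (*"localized near □"*): **`W1kinCube_congr`** — `W₁,kin(□)` depends only on `ψ` on the sites of `□` and on `φ`, `U`, `A`
  on their blocks.
* §7 the printed bound: `abs_W1kin_le_scale` (site), `abs_W1kinCube_le_scale` (cube, `K·e^{n̄−1}(log e⁻¹)^q`), **`ineq5613_kinetic`**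
  (r16's leaf `BIJ88Sect5StatementsPart2.Ineq5613` for `W₁ = W1kinCube …`, all `0 < e_k ≤ min(e⁻¹, threshold)`).
* §8 the two other kinetic sources of `W₁` (companion file `W1_eq_sources`): `abs_normSq_sub_normSq_le`, **`abs_kin_phase_sub_le`**
  (phase factors `|P − 1| ≤ δ` on `ψ`, `φ`: `≤ |κ|δ(2+δ)ρ₀²`), **`abs_kin_w1_sub_le`** (extra transporter phases `|e^{iA′} − 1| ≤ δ′`:
  `≤ |κ|δ′ρ₁(2ρ₀ + δ′ρ₁)`) — with `δ, δ′ = O(e_ke^{−cr(e_k)})` by (5.4.7) (p31 g10 `BIJ88Insertions288.norm_phase_sub_one_le`) these are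
  below every power of `e_k` (`BIJ88Eq5613Summary.exp_neg_mul_rLen_le_rpow`).
HONEST SCOPE.  One action term of three (the `Δ_{k,loc}` and `𝒫_{k,loc}` terms are not treated here; the latter is deferred by the
paper itself, p. 275); abstract block data `B(y)`, weight `w`, transporters `U` and contour sums `A` (their identification with
`L^{−d}`, `ũ_{k+1}(Γ^{(1)}_{y,x})`, `e_kη(θ_kH_{k,loc}A^{(k)})(Γ^{(1)}_{y,x})` is the instance's); the small-field radii, `|A^{(k)}| ≲ p(e_k)`
((5.1.x)/(5.9.4)) and the `H_{k,loc}` row sums (2.5) enter as the DISPLAYED hypotheses `G ≤ c_Ge_kp(e_k)`, `e_kΦ ≤ c_Φp(e_k)`,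
`e_kΨ ≤ c_Ψp(e_k)`, not derived; Taylor weights `1/n!` as in p02's reading (i) (GAPS G-C2-11).  Imports the companion
`BIJ88Eq5613Summary`; no Summits import; modifies nothing.  Unit `lit-balaban-p31` (literature-prover-lit-balaban-p31-g11-0),
2026-08-22.  NOT summit progress; NOT continuum; NOT Clay.
-/

noncomputable section

open Complex
open scoped BigOperators ComplexConjugate
open Set

namespace Literature.MathematicalPhysics.QuantumFieldTheory.BalabanImbrieJaffe1984to88.BIJ88Eq5613Kinetic

open BIJ88Sect5StatementsPart4 (covAvg F2 eq568)
open BIJ88TaylorSplit5614 (Rtilde Ftilde)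
open BIJ88Eq5613Summary (split norm_Ftilde_le_of_contDiff Rtilde_sum Ftilde_sum cubeSum cubeSum_congr norm_cubeSum_le
  sum_eq_sum_cubeSum ineq5613_of_cube_bounds absorb_logs threshold pLog_eq_rpow rLen_eq_rpow one_le_log_inv
  log_rpow_le_log_rpow log_rpow_mul_log_rpow log_rpow_pow le_one_of_le_exp_neg_one)
open BIJ88Sect5StatementsPart2 (Ineq5613)
open BIJ88Sect2Statements (pLog rLen)

variable {α β : Type*}

/-! ## §1 The interpolated transporters, the site residual and the kinetic site density -/

/-- The phase `e^{ie′a}` of one transporter along the interpolation `e′ ↦ ũ_{k+1}e^{ie′e_kηθ_kH_{k,loc}A^{(k)}}` of (5.6.14)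
(`a = A(y,x)`, the contour sum; real parameter `t = e′`). [cite: BalabanImbrieJaffe1988, (5.6.14) p.288] -/
def ephase (a t : ℝ) : ℂ := Complex.exp (((t * a : ℝ) : ℂ) * I)

/-- kernel: `e^{ie′a} = exp((ia)·e′)`. [cite: BalabanImbrieJaffe1988, (5.6.14) p.288] -/
theorem ephase_eq (a t : ℝ) : ephase a t = Complex.exp ((a * I) * (t : ℂ)) := by
  simp only [ephase, Complex.ofReal_mul]; ring_nf

/-- kernel: `|e^{ie′a}| = 1`. [cite: BalabanImbrieJaffe1988, (5.6.14) p.288] -/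
theorem norm_ephase (a t : ℝ) : ‖ephase a t‖ = 1 := by
  rw [ephase, Complex.norm_exp_ofReal_mul_I]

/-- kernel: `e^{i·0·a} = 1`. [cite: BalabanImbrieJaffe1988, (5.6.14) p.288] -/
theorem ephase_zero (a : ℝ) : ephase a 0 = 1 := by simp [ephase]

/-- The interpolated transporters `U(y,x)e^{ie′A(y,x)}` of (5.6.14) (`U(y,x) = ũ_{k+1}(Γ_{y,x})`, `A(y,x) =
e_kη(θ_kH_{k,loc}A^{(k)})(Γ_{y,x})`). [cite: BalabanImbrieJaffe1988, (5.6.14) p.288] -/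
def twist (U : β → α → ℂ) (A : β → α → ℝ) (t : ℝ) : β → α → ℂ := fun y x => U y x * ephase (A y x) t

/-- kernel: at `e′ = 0` the transporters are those of `ũ_{k+1}`. [cite: BalabanImbrieJaffe1988, (5.6.14) p.288] -/
theorem twist_zero (U : β → α → ℂ) (A : β → α → ℝ) : twist U A 0 = U := by
  funext y x; simp [twist, ephase_zero]

/-- kernel: at `e′ = 1` the transporters are `ũ_{k+1}(Γ)e^{iA(Γ)}` = those of `ũ_{k+1}e^{ie_kηθ_kH_{k,loc}A^{(k)}}`.
[cite: BalabanImbrieJaffe1988, (5.6.14) p.288] -/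
theorem twist_one (U : β → α → ℂ) (A : β → α → ℝ) :
    twist U A 1 = fun y x => U y x * Complex.exp ((A y x : ℂ) * I) := by
  funext y x; simp [twist, ephase]

/-- **(5.6.8) at `e′ = 1`**: `Q(ũ_{k+1}e^{iA}) = Q(ũ_{k+1}) + F₂(iA, ũ_{k+1})` — r16's `eq568` for the interpolated transporters
(*"Inserting this formula into |(ψ − Q(ũ_{k+1}ũ)φ)(y)|², we obtain the vertices new to this step"*).
[cite: BalabanImbrieJaffe1988, (5.6.8) p.287] -/
theorem covAvg_twist_one (B : β → Finset α) (w : ℝ) (U : β → α → ℂ) (A : β → α → ℝ) (φ : α → ℂ) (y : β) :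
    covAvg B w (twist U A 1) φ y = covAvg B w U φ y + F2 B w U (fun y x => (A y x : ℂ) * I) φ y := by
  rw [twist_one]
  exact eq568 B w U _ φ y

/-- The site residual `r_y(e′) = ψ(y) − (Q(ũ_{k+1}e^{ie′…})φ)(y)` of the kinetic term along the interpolation.
[cite: BalabanImbrieJaffe1988, (5.6.14) p.288] -/
def resid (B : β → Finset α) (w : ℝ) (U : β → α → ℂ) (A : β → α → ℝ) (φ : α → ℂ) (ψ : β → ℂ) (y : β) (t : ℝ) : ℂ :=
  ψ y - covAvg B w (twist U A t) φ y

/-- kernel: the interpolated block average is the exponential sum `Σ_{x∈B(y)} wU(y,x)φ(x)·e^{ie′A(y,x)}`.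
[cite: BalabanImbrieJaffe1988, (5.6.8) p.287] -/
theorem covAvg_twist_eq (B : β → Finset α) (w : ℝ) (U : β → α → ℂ) (A : β → α → ℝ) (φ : α → ℂ) (y : β) (t : ℝ) :
    covAvg B w (twist U A t) φ y = ∑ x ∈ B y, ((w : ℂ) * U y x * φ x) * ephase (A y x) t := by
  unfold covAvg twist
  exact Finset.sum_congr rfl fun x _ => by ring

/-- kernel: at `e′ = 0` the residual is `ψ(y) − (Q(ũ_{k+1})φ)(y)` — the right side's kinetic term of (5.6.13).
[cite: BalabanImbrieJaffe1988, (5.6.13) p.288] -/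
theorem resid_zero_eq (B : β → Finset α) (w : ℝ) (U : β → α → ℂ) (A : β → α → ℝ) (φ : α → ℂ) (ψ : β → ℂ) (y : β) :
    resid B w U A φ ψ y 0 = ψ y - covAvg B w U φ y := by
  rw [resid, twist_zero]

/-- The kinetic site density `S_y(e′) = κ|ψ(y) − (Q(ũ_{k+1}e^{ie′…})φ)(y)|²` of (5.6.14)₁ (`κ` = `½aL⁻²` times the lattice weight of
the site `y`). [cite: BalabanImbrieJaffe1988, (5.6.14) p.288] -/
def kin (κ : ℝ) (B : β → Finset α) (w : ℝ) (U : β → α → ℂ) (A : β → α → ℝ) (φ : α → ℂ) (ψ : β → ℂ) (y : β) (t : ℝ) : ℝ :=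
  κ * ‖resid B w U A φ ψ y t‖ ^ 2

/-- kernel: `S_y(0) = κ|ψ(y) − (Q(ũ_{k+1})φ)(y)|²` (the main kinetic term on the right of (5.6.13)).
[cite: BalabanImbrieJaffe1988, (5.6.13) p.288] -/
theorem kin_zero (κ : ℝ) (B : β → Finset α) (w : ℝ) (U : β → α → ℂ) (A : β → α → ℝ) (φ : α → ℂ) (ψ : β → ℂ) (y : β) :
    kin κ B w U A φ ψ y 0 = κ * ‖ψ y - covAvg B w U φ y‖ ^ 2 := by
  rw [kin, resid_zero_eq]

/-- kernel: `S_y(1) = κ|ψ(y) − ((Q(ũ_{k+1}) + F₂)φ)(y)|²` (the kinetic term at `ũ_{k+1}e^{ie_kηθ_kH_{k,loc}A^{(k)}}`, (5.6.8) inserted).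
[cite: BalabanImbrieJaffe1988, (5.6.8) p.287] -/
theorem kin_one (κ : ℝ) (B : β → Finset α) (w : ℝ) (U : β → α → ℂ) (A : β → α → ℝ) (φ : α → ℂ) (ψ : β → ℂ) (y : β) :
    kin κ B w U A φ ψ y 1 = κ * ‖ψ y - (covAvg B w U φ y + F2 B w U (fun y x => (A y x : ℂ) * I) φ y)‖ ^ 2 := by
  rw [kin, resid, covAvg_twist_one]

/-! ## §2 Smoothness and the derivative formulas -/

/-- kernel: `d/de′ e^{ie′a} = (ia)e^{ie′a}`. [cite: BalabanImbrieJaffe1988, (5.6.14) p.288] -/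
theorem hasDerivAt_ephase (a t : ℝ) : HasDerivAt (ephase a) ((a * I) * ephase a t) t := by
  have h1 : HasDerivAt (fun s : ℝ => (a * I) * (s : ℂ)) ((a * I) * 1) t :=
    ((hasDerivAt_id t).ofReal_comp).const_mul _
  have h2 := h1.cexp
  have h3 : (fun s : ℝ => Complex.exp ((a * I) * (s : ℂ))) = ephase a := by
    funext s; rw [ephase_eq]
  rw [h3] at h2
  convert h2 using 1
  rw [← ephase_eq]; ring

/-- kernel: `dⁿ/de′ⁿ e^{ie′a} = (ia)ⁿe^{ie′a}`. [cite: BalabanImbrieJaffe1988, (5.6.14) p.288] -/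
theorem iteratedDeriv_ephase (a : ℝ) : ∀ n : ℕ, iteratedDeriv n (ephase a) = fun t => (a * I) ^ n * ephase a t
  | 0 => by funext t; simp
  | n + 1 => by
    rw [iteratedDeriv_succ, iteratedDeriv_ephase a n]
    funext t
    have h : HasDerivAt (fun s => (a * I) ^ n * ephase a s) ((a * I) ^ n * ((a * I) * ephase a t)) t :=
      (hasDerivAt_ephase a t).const_mul _
    rw [h.deriv]; ring

/-- kernel: `e′ ↦ e^{ie′a}` is smooth. [cite: BalabanImbrieJaffe1988, (5.6.14) p.288] -/
theorem contDiff_ephase (a : ℝ) {n : WithTop ℕ∞} : ContDiff ℝ n (ephase a) := by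
  have : ephase a = fun s : ℝ => Complex.exp ((a * I) * (s : ℂ)) := by funext s; rw [ephase_eq]
  rw [this]
  exact (contDiff_const.mul Complex.ofRealCLM.contDiff).cexp

/-- kernel: `dⁿ/de′ⁿ (Q(ũ_{k+1}e^{ie′…})φ)(y) = Σ_{x∈B(y)} wU(y,x)φ(x)(iA(y,x))ⁿe^{ie′A(y,x)}` (every `n ≥ 0`).
[cite: BalabanImbrieJaffe1988, (5.6.14) p.288] -/
theorem iteratedDeriv_covAvg_twist (B : β → Finset α) (w : ℝ) (U : β → α → ℂ) (A : β → α → ℝ) (φ : α → ℂ) (y : β)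
    (n : ℕ) (t : ℝ) :
    iteratedDeriv n (fun s => covAvg B w (twist U A s) φ y) t
      = ∑ x ∈ B y, ((w : ℂ) * U y x * φ x) * ((A y x * I) ^ n * ephase (A y x) t) := by
  have hf : (fun s => covAvg B w (twist U A s) φ y) = fun s => ∑ x ∈ B y, ((w : ℂ) * U y x * φ x) * ephase (A y x) s := by
    funext s; exact covAvg_twist_eq B w U A φ y s
  rw [hf, iteratedDeriv_fun_sum (f := fun x s => ((w : ℂ) * U y x * φ x) * ephase (A y x) s)
    fun x _ => (contDiff_const.mul (contDiff_ephase (A y x))).contDiffAt]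
  refine Finset.sum_congr rfl fun x _ => ?_
  rw [iteratedDeriv_const_mul _ (contDiff_ephase (A y x)).contDiffAt, iteratedDeriv_ephase]

/-- kernel: the interpolated block average is smooth in `e′`. [cite: BalabanImbrieJaffe1988, (5.6.14) p.288] -/
theorem contDiff_covAvg_twist (B : β → Finset α) (w : ℝ) (U : β → α → ℂ) (A : β → α → ℝ) (φ : α → ℂ) (y : β)
    {n : WithTop ℕ∞} : ContDiff ℝ n (fun s => covAvg B w (twist U A s) φ y) := by
  have hf : (fun s => covAvg B w (twist U A s) φ y) = fun s => ∑ x ∈ B y, ((w : ℂ) * U y x * φ x) * ephase (A y x) s := by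
    funext s; exact covAvg_twist_eq B w U A φ y s
  rw [hf]
  exact ContDiff.sum fun x _ => contDiff_const.mul (contDiff_ephase (A y x))

/-- kernel: the site residual is smooth in `e′`. [cite: BalabanImbrieJaffe1988, (5.6.14) p.288] -/
theorem contDiff_resid (B : β → Finset α) (w : ℝ) (U : β → α → ℂ) (A : β → α → ℝ) (φ : α → ℂ) (ψ : β → ℂ) (y : β)
    {n : WithTop ℕ∞} : ContDiff ℝ n (resid B w U A φ ψ y) :=
  contDiff_const.sub (contDiff_covAvg_twist B w U A φ y)

/-- **The derivatives of the residual**: `dⁿ⁺¹r_y/de′ⁿ⁺¹ = −Σ_{x∈B(y)} wU(y,x)φ(x)(iA(y,x))ⁿ⁺¹e^{ie′A(y,x)}` — each `e′`-derivative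
brings one factor `iA(y,x) = ie_kη(θ_kH_{k,loc}A^{(k)})(Γ_{y,x})`, i.e. one power of `e_k` (*"terms of higher than n̄-th order in
e_k"*). [cite: BalabanImbrieJaffe1988, (5.6.14) p.288] -/
theorem iteratedDeriv_resid_succ (B : β → Finset α) (w : ℝ) (U : β → α → ℂ) (A : β → α → ℝ) (φ : α → ℂ) (ψ : β → ℂ)
    (y : β) (n : ℕ) (t : ℝ) :
    iteratedDeriv (n + 1) (resid B w U A φ ψ y) t
      = -∑ x ∈ B y, ((w : ℂ) * U y x * φ x) * ((A y x * I) ^ (n + 1) * ephase (A y x) t) := by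
  unfold resid
  rw [iteratedDeriv_const_sub (Nat.succ_pos n), iteratedDeriv_neg, iteratedDeriv_covAvg_twist]

section Kin

variable (κ : ℝ) (B : β → Finset α) (w : ℝ) (U : β → α → ℂ) (A : β → α → ℝ) (φ : α → ℂ) (ψ : β → ℂ) (y : β)

/-- kernel: `|r|² = ⟪r, r⟫_ℝ` — the site density is a bounded real-bilinear form of the residual (`innerSL ℝ` on `ℂ`).
[cite: BalabanImbrieJaffe1988, (5.6.14) p.288] -/
theorem normSq_eq_innerSL (t : ℝ) :
    ‖resid B w U A φ ψ y t‖ ^ 2 = (innerSL ℝ (resid B w U A φ ψ y t)) (resid B w U A φ ψ y t) := by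
  rw [innerSL_apply_apply, real_inner_self_eq_norm_sq]

/-- kernel: `e′ ↦ |r_y(e′)|²` is smooth. [cite: BalabanImbrieJaffe1988, (5.6.14) p.288] -/
theorem contDiff_normSq {n : WithTop ℕ∞} : ContDiff ℝ n (fun t => ‖resid B w U A φ ψ y t‖ ^ 2) :=
  (contDiff_resid B w U A φ ψ y).norm_sq ℝ

/-- kernel: the kinetic site density is smooth in `e′` (so `R̃^{(k)}` of (5.6.14)₁ and the remainder exist to every order).
[cite: BalabanImbrieJaffe1988, (5.6.14) p.288] -/
theorem contDiff_kin {n : WithTop ℕ∞} : ContDiff ℝ n (kin κ B w U A φ ψ y) :=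
  contDiff_const.mul (contDiff_normSq B w U A φ ψ y)

/-- kernel: `dⁿS_y/de′ⁿ = κ·dⁿ|r_y|²/de′ⁿ`. [cite: BalabanImbrieJaffe1988, (5.6.14) p.288] -/
theorem iteratedDeriv_kin (n : ℕ) (t : ℝ) :
    iteratedDeriv n (kin κ B w U A φ ψ y) t = κ * iteratedDeriv n (fun t => ‖resid B w U A φ ψ y t‖ ^ 2) t := by
  unfold kin
  exact iteratedDeriv_const_mul κ (contDiff_normSq B w U A φ ψ y (n := n)).contDiffAt

/-- kernel (bilinear Leibniz bound): `‖dⁿ|r_y|²/de′ⁿ‖ ≤ Σ_i C(n,i)‖r^{(i)}‖‖r^{(n−i)}‖`. [cite: BalabanImbrieJaffe1988, (5.6.14) p.288] -/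
theorem norm_iteratedDeriv_normSq_le (n : ℕ) (t : ℝ) :
    ‖iteratedDeriv n (fun t => ‖resid B w U A φ ψ y t‖ ^ 2) t‖ ≤
      ∑ i ∈ Finset.range (n + 1), (n.choose i : ℝ) * ‖iteratedDeriv i (resid B w U A φ ψ y) t‖ *
        ‖iteratedDeriv (n - i) (resid B w U A φ ψ y) t‖ := by
  have hfun : (fun t => ‖resid B w U A φ ψ y t‖ ^ 2) =
      fun t => (innerSL ℝ (resid B w U A φ ψ y t)) (resid B w U A φ ψ y t) := by
    funext t; exact normSq_eq_innerSL B w U A φ ψ y t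
  rw [hfun, ← norm_iteratedFDeriv_eq_norm_iteratedDeriv]
  have h := ContinuousLinearMap.norm_iteratedFDeriv_le_of_bilinear_of_le_one (innerSL ℝ (E := ℂ))
    (contDiff_resid B w U A φ ψ y (n := n)) (contDiff_resid B w U A φ ψ y (n := n)) t (n := n) le_rfl
    (norm_innerSL_le ℝ)
  simpa only [norm_iteratedFDeriv_eq_norm_iteratedDeriv] using h

end Kin

/-! ## §3 The derivative bounds -/

section Bounds

/-- `ρ₁(y) = |w|·Σ_{x∈B(y)}‖φ(x)‖` — the size of the block average of `|φ|` at `y` (unit transporters).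
[cite: BalabanImbrieJaffe1988, (5.6.13) p.288] -/
def rho1 (B : β → Finset α) (w : ℝ) (φ : α → ℂ) (y : β) : ℝ := |w| * ∑ x ∈ B y, ‖φ x‖

/-- kernel: `ρ₁ ≥ 0`. [cite: BalabanImbrieJaffe1988, (5.6.13) p.288] -/
theorem rho1_nonneg (B : β → Finset α) (w : ℝ) (φ : α → ℂ) (y : β) : 0 ≤ rho1 B w φ y :=
  mul_nonneg (abs_nonneg _) (Finset.sum_nonneg fun _ _ => norm_nonneg _)

/-- kernel: under a field bound `‖φ‖ ≤ Φ` on the block and the normalisation `|w|·|B(y)| ≤ 1` (`w = L^{−d}`, `|B(y)| = L^d`),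
`ρ₁(y) ≤ Φ`. [cite: BalabanImbrieJaffe1988, (5.6.13) p.288] -/
theorem rho1_le_of_fieldBound (B : β → Finset α) (w : ℝ) (φ : α → ℂ) (y : β) {Φ : ℝ} (hΦ : 0 ≤ Φ)
    (hφ : ∀ x ∈ B y, ‖φ x‖ ≤ Φ) (hw : |w| * (B y).card ≤ 1) : rho1 B w φ y ≤ Φ := by
  unfold rho1
  calc |w| * ∑ x ∈ B y, ‖φ x‖ ≤ |w| * ∑ x ∈ B y, Φ := by gcongr with x hx; exact hφ x hx
    _ = |w| * (B y).card * Φ := by rw [Finset.sum_const, nsmul_eq_mul]; ring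
    _ ≤ 1 * Φ := by gcongr
    _ = Φ := one_mul Φ

variable {B : β → Finset α} {w : ℝ} {U : β → α → ℂ} {A : β → α → ℝ} {φ : α → ℂ} {ψ : β → ℂ} {y : β}

/-- kernel: `‖Σ_{x∈B(y)} wU(y,x)φ(x)(iA(y,x))ⁿe^{ie′A(y,x)}‖ ≤ Gⁿρ₁(y)` for `|U| ≤ 1`, `|A(y,x)| ≤ G`.
[cite: BalabanImbrieJaffe1988, (5.6.13) p.288] -/
theorem norm_sum_weight_le {G : ℝ} (hU : ∀ x ∈ B y, ‖U y x‖ ≤ 1) (hA : ∀ x ∈ B y, |A y x| ≤ G) (n : ℕ) (t : ℝ) :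
    ‖∑ x ∈ B y, ((w : ℂ) * U y x * φ x) * ((A y x * I) ^ n * ephase (A y x) t)‖ ≤ G ^ n * rho1 B w φ y := by
  rw [rho1, Finset.mul_sum, Finset.mul_sum]
  refine (norm_sum_le _ _).trans (Finset.sum_le_sum fun x hx => ?_)
  rw [norm_mul, norm_mul, norm_mul, norm_mul, norm_pow, norm_mul, Complex.norm_I, mul_one, Complex.norm_real,
    Real.norm_eq_abs, norm_ephase, mul_one, Complex.norm_real, Real.norm_eq_abs]
  have h1 : |A y x| ^ n ≤ G ^ n := pow_le_pow_left₀ (abs_nonneg _) (hA x hx) n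
  have h2 : |w| * ‖U y x‖ * ‖φ x‖ ≤ |w| * 1 * ‖φ x‖ := by
    gcongr
    exact hU x hx
  calc |w| * ‖U y x‖ * ‖φ x‖ * |A y x| ^ n ≤ (|w| * 1 * ‖φ x‖) * G ^ n := by gcongr
    _ = G ^ n * (|w| * ‖φ x‖) := by ring

/-- **`‖dⁿ⁺¹r_y/de′ⁿ⁺¹‖ ≤ Gⁿ⁺¹ρ₁(y)`** (`|U| ≤ 1`, `|A(y,x)| ≤ G`). [cite: BalabanImbrieJaffe1988, (5.6.13) p.288] -/
theorem norm_iteratedDeriv_resid_succ_le {G : ℝ} (hU : ∀ x ∈ B y, ‖U y x‖ ≤ 1)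
    (hA : ∀ x ∈ B y, |A y x| ≤ G) (n : ℕ) (t : ℝ) :
    ‖iteratedDeriv (n + 1) (resid B w U A φ ψ y) t‖ ≤ G ^ (n + 1) * rho1 B w φ y := by
  rw [iteratedDeriv_resid_succ, norm_neg]
  exact norm_sum_weight_le hU hA (n + 1) t

/-- kernel: `‖(Q(ũ_{k+1}e^{ie′…})φ)(y)‖ ≤ ρ₁(y)` (`|U| ≤ 1`). [cite: BalabanImbrieJaffe1988, (5.6.13) p.288] -/
theorem norm_covAvg_twist_le (hU : ∀ x ∈ B y, ‖U y x‖ ≤ 1) (t : ℝ) :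
    ‖covAvg B w (twist U A t) φ y‖ ≤ rho1 B w φ y := by
  have h := norm_sum_weight_le (w := w) (φ := φ) (G := |0| + ∑ x ∈ B y, |A y x|) hU
    (fun x hx => by
      rw [abs_zero, zero_add]
      exact Finset.single_le_sum (f := fun x => |A y x|) (fun _ _ => abs_nonneg _) hx) 0 t
  simpa [covAvg_twist_eq] using h

/-- kernel: `‖r_y(e′)‖ ≤ ‖ψ(y)‖ + ρ₁(y) =: ρ₀(y)` along the whole interpolation. [cite: BalabanImbrieJaffe1988, (5.6.13) p.288] -/
theorem norm_resid_le (hU : ∀ x ∈ B y, ‖U y x‖ ≤ 1) (t : ℝ) :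
    ‖resid B w U A φ ψ y t‖ ≤ ‖ψ y‖ + rho1 B w φ y := by
  unfold resid
  exact (norm_sub_le _ _).trans (add_le_add le_rfl (norm_covAvg_twist_le hU t))

/-- kernel (the combinatorial step): if `b₀ ≤ ρ₀`, `b_{i+1} ≤ G^{i+1}ρ₁` and `ρ₁ ≤ ρ₀`, then for `n ≥ 1`
`Σ_{i=0}^{n} C(n,i)b_ib_{n−i} ≤ (2G)ⁿρ₁ρ₀` — every product has at least one derivative factor.
[cite: BalabanImbrieJaffe1988, (5.6.13) p.288] -/
theorem choose_sum_bound {G ρ₁ ρ₀ : ℝ} (hG : 0 ≤ G) (hρ₁ : 0 ≤ ρ₁) (hρ : ρ₁ ≤ ρ₀) {b : ℕ → ℝ} (hb0 : ∀ i, 0 ≤ b i)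
    (h0 : b 0 ≤ ρ₀) (hS : ∀ i, b (i + 1) ≤ G ^ (i + 1) * ρ₁) {n : ℕ} (hn : 1 ≤ n) :
    ∑ i ∈ Finset.range (n + 1), (n.choose i : ℝ) * b i * b (n - i) ≤ (2 * G) ^ n * ρ₁ * ρ₀ := by
  have hρ₀ : 0 ≤ ρ₀ := hρ₁.trans hρ
  have key : ∀ i ∈ Finset.range (n + 1), (n.choose i : ℝ) * b i * b (n - i) ≤ (n.choose i : ℝ) * (G ^ n * ρ₁ * ρ₀) := by
    intro i hi
    rw [Finset.mem_range] at hi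
    rw [mul_assoc]
    refine mul_le_mul_of_nonneg_left ?_ (Nat.cast_nonneg _)
    rcases Nat.eq_zero_or_pos i with rfl | hi0
    · obtain ⟨m, rfl⟩ : ∃ m, n = m + 1 := ⟨n - 1, by omega⟩
      rw [Nat.sub_zero]
      calc b 0 * b (m + 1) ≤ ρ₀ * (G ^ (m + 1) * ρ₁) := mul_le_mul h0 (hS m) (hb0 _) hρ₀
        _ = G ^ (m + 1) * ρ₁ * ρ₀ := by ring
    · obtain ⟨i, rfl⟩ : ∃ i', i = i' + 1 := ⟨i - 1, by omega⟩
      rcases Nat.eq_zero_or_pos (n - (i + 1)) with hz | hz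
      · have hn' : n = i + 1 := by omega
        rw [hz, hn']
        calc b (i + 1) * b 0 ≤ (G ^ (i + 1) * ρ₁) * ρ₀ := mul_le_mul (hS i) h0 (hb0 _) (by positivity)
          _ = G ^ (i + 1) * ρ₁ * ρ₀ := by ring
      · obtain ⟨m, hm⟩ : ∃ m, n - (i + 1) = m + 1 := ⟨n - (i + 1) - 1, by omega⟩
        rw [hm]
        have hn' : n = (i + 1) + (m + 1) := by omega
        calc b (i + 1) * b (m + 1) ≤ (G ^ (i + 1) * ρ₁) * (G ^ (m + 1) * ρ₁) :=
              mul_le_mul (hS i) (hS m) (hb0 _) (by positivity)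
          _ = G ^ n * ρ₁ * ρ₁ := by rw [hn', pow_add]; ring
          _ ≤ G ^ n * ρ₁ * ρ₀ := by gcongr
  refine (Finset.sum_le_sum key).trans ?_
  rw [← Finset.sum_mul]
  have hc : ∑ i ∈ Finset.range (n + 1), (n.choose i : ℝ) = 2 ^ n := by exact_mod_cast Nat.sum_range_choose n
  rw [hc, mul_pow]
  ring_nf
  exact le_rfl

/-- kernel: `‖dⁿ|r_y|²/de′ⁿ‖ ≤ (2G)ⁿρ₁(y)(‖ψ(y)‖ + ρ₁(y))` for `n ≥ 1`. [cite: BalabanImbrieJaffe1988, (5.6.13) p.288] -/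
theorem norm_iteratedDeriv_normSq_le_of_bounds {G : ℝ} (hG : 0 ≤ G) (hU : ∀ x ∈ B y, ‖U y x‖ ≤ 1)
    (hA : ∀ x ∈ B y, |A y x| ≤ G) {n : ℕ} (hn : 1 ≤ n) (t : ℝ) :
    ‖iteratedDeriv n (fun t => ‖resid B w U A φ ψ y t‖ ^ 2) t‖ ≤
      (2 * G) ^ n * rho1 B w φ y * (‖ψ y‖ + rho1 B w φ y) := by
  refine (norm_iteratedDeriv_normSq_le B w U A φ ψ y n t).trans ?_
  refine choose_sum_bound hG (rho1_nonneg B w φ y) (le_add_of_nonneg_left (norm_nonneg _))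
    (b := fun i => ‖iteratedDeriv i (resid B w U A φ ψ y) t‖)
    (fun _ => norm_nonneg _) ?_ (fun i => norm_iteratedDeriv_resid_succ_le hU hA i t) hn
  simpa using norm_resid_le (A := A) (ψ := ψ) hU t

/-- **The derivative bound of the kinetic site family**: `|dⁿS_y/de′ⁿ| ≤ |κ|(2G)ⁿρ₁(y)(‖ψ(y)‖ + ρ₁(y))` for `n ≥ 1`, uniformly in
`e′` (`|U| ≤ 1`, `|A(y,x)| ≤ G`). [cite: BalabanImbrieJaffe1988, (5.6.13) p.288] -/
theorem abs_iteratedDeriv_kin_le (κ : ℝ) {G : ℝ} (hG : 0 ≤ G) (hU : ∀ x ∈ B y, ‖U y x‖ ≤ 1) (hA : ∀ x ∈ B y, |A y x| ≤ G)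
    {n : ℕ} (hn : 1 ≤ n) (t : ℝ) :
    |iteratedDeriv n (kin κ B w U A φ ψ y) t| ≤ |κ| * ((2 * G) ^ n * rho1 B w φ y * (‖ψ y‖ + rho1 B w φ y)) := by
  rw [iteratedDeriv_kin, abs_mul]
  refine mul_le_mul_of_nonneg_left ?_ (abs_nonneg κ)
  rw [← Real.norm_eq_abs]
  exact norm_iteratedDeriv_normSq_le_of_bounds hG hU hA hn t

end Bounds

/-! ## §4 The order-`> n̄` Taylor remainder `W₁,kin(y)` -/

section Taylor

variable (κ : ℝ) (B : β → Finset α) (w : ℝ) (U : β → α → ℂ) (A : β → α → ℝ) (φ : α → ℂ) (ψ : β → ℂ)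

/-- **`W₁,kin(y)`**: the kinetic site contribution to `Σ_□W₁^{(k)}(□)` of (5.6.13) from the *"terms of higher than n̄-th order in e_k"*
— the Taylor remainder of order `> n̄` at `e′ = 1` of the site family (p02's `Ftilde`: `S_y(1) − S_y(0) − R̃_y`).
[cite: BalabanImbrieJaffe1988, (5.6.13) p.288] -/
def W1kin (nbar : ℕ) (y : β) : ℝ := Ftilde (kin κ B w U A φ ψ y) nbar

/-- **(5.6.13) for the kinetic site density**: `S_y(1) = S_y(0) + R̃_y + W₁,kin(y)` — kinetic term at `ũ_{k+1}e^{iA}` = kinetic term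
at `ũ_{k+1}` + its part of `R̃^{(k)}` ((5.6.14)₁, orders `1…n̄`) + `W₁,kin(y)`. [cite: BalabanImbrieJaffe1988, (5.6.13) p.288] -/
theorem eq5613_kin_site (nbar : ℕ) (y : β) :
    kin κ B w U A φ ψ y 1 = kin κ B w U A φ ψ y 0 + Rtilde (kin κ B w U A φ ψ y) nbar + W1kin κ B w U A φ ψ nbar y :=
  split _ nbar

/-- kernel: `R̃_y = Σ_{n=1}^{n̄}(1/n!)dⁿS_y/de′ⁿ(0)` with ordinary derivatives (the site family is smooth).
[cite: BalabanImbrieJaffe1988, (5.6.14) p.288] -/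
theorem Rtilde_kin_eq (nbar : ℕ) (y : β) :
    Rtilde (kin κ B w U A φ ψ y) nbar
      = ∑ n ∈ Finset.range nbar, ((1 : ℝ) / (n + 1).factorial) • iteratedDeriv (n + 1) (kin κ B w U A φ ψ y) 0 :=
  BIJ88Eq5613Summary.Rtilde_eq_sum_iteratedDeriv (fun _ => contDiff_kin κ B w U A φ ψ y) nbar

variable {B w U A φ ψ}

/-- **`|W₁,kin(y)| ≤ |κ|(2G)^{n̄+1}ρ₁(y)(‖ψ(y)‖ + ρ₁(y))/n̄!`** (`|U| ≤ 1`, `|A(y,x)| ≤ G`): `n̄ + 1` powers of the exponent scale `G`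
against two field factors. [cite: BalabanImbrieJaffe1988, (5.6.13) p.288] -/
theorem abs_W1kin_le {G : ℝ} (hG : 0 ≤ G) {y : β} (hU : ∀ x ∈ B y, ‖U y x‖ ≤ 1) (hA : ∀ x ∈ B y, |A y x| ≤ G) (nbar : ℕ) :
    |W1kin κ B w U A φ ψ nbar y| ≤
      |κ| * ((2 * G) ^ (nbar + 1) * rho1 B w φ y * (‖ψ y‖ + rho1 B w φ y)) / nbar.factorial := by
  rw [W1kin, ← Real.norm_eq_abs]
  exact norm_Ftilde_le_of_contDiff (fun _ => contDiff_kin κ B w U A φ ψ y) fun t _ => by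
    rw [Real.norm_eq_abs]
    exact abs_iteratedDeriv_kin_le κ hG hU hA (Nat.succ_pos nbar) t

/-- The same with field bounds: `‖φ‖ ≤ Φ` on `B(y)`, `‖ψ(y)‖ ≤ Ψ`, `|w||B(y)| ≤ 1` give
`|W₁,kin(y)| ≤ |κ|(2G)^{n̄+1}Φ(Ψ + Φ)/n̄!`. [cite: BalabanImbrieJaffe1988, (5.6.13) p.288] -/
theorem abs_W1kin_le_of_fieldBounds {G Φ Ψ : ℝ} (hG : 0 ≤ G) (hΦ : 0 ≤ Φ) {y : β} (hU : ∀ x ∈ B y, ‖U y x‖ ≤ 1)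
    (hA : ∀ x ∈ B y, |A y x| ≤ G) (hφ : ∀ x ∈ B y, ‖φ x‖ ≤ Φ) (hψ : ‖ψ y‖ ≤ Ψ) (hw : |w| * (B y).card ≤ 1) (nbar : ℕ) :
    |W1kin κ B w U A φ ψ nbar y| ≤ |κ| * ((2 * G) ^ (nbar + 1) * Φ * (Ψ + Φ)) / nbar.factorial := by
  have h1 := rho1_le_of_fieldBound B w φ y hΦ hφ hw
  have h0 := rho1_nonneg B w φ y
  refine (abs_W1kin_le κ hG hU hA nbar).trans (div_le_div_of_nonneg_right ?_ (Nat.cast_nonneg _))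
  refine mul_le_mul_of_nonneg_left ?_ (abs_nonneg κ)
  exact mul_le_mul (mul_le_mul_of_nonneg_left h1 (pow_nonneg (by positivity) _)) (add_le_add hψ h1)
    (add_nonneg (norm_nonneg _) h0) (mul_nonneg (pow_nonneg (by positivity) _) hΦ)

end Taylor

/-! ## §5 Sites and cubes: the kinetic line of (5.6.13) -/

section Cubes

variable {σ : Type*} {γ : Type*} [DecidableEq γ]
variable (κ : ℝ) (B : β → Finset α) (w : ℝ) (U : β → α → ℂ) (A : β → α → ℝ) (φ : α → ℂ) (ψ : β → ℂ)

/-- **`W₁,kin(□) = Σ_{y∈□}W₁,kin(y)`** — the kinetic cube term (companion `cubeSum` over a cube assignment `cube` of the `ψ`-sites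
`Y`; *"W₁^{(k)}(□) is localized near □, an r(e_k)-cube"*). [cite: BalabanImbrieJaffe1988, (5.6.13) p.288] -/
def W1kinCube (nbar : ℕ) (Y : Finset β) (cube : β → γ) (c : γ) : ℝ :=
  cubeSum Y cube (W1kin κ B w U A φ ψ nbar) c

/-- kernel: the total kinetic family `Σ_{y∈Y}S_y` has `R̃ = Σ_yR̃_y` (its part of `R̃^{(k)}`).
[cite: BalabanImbrieJaffe1988, (5.6.14) p.288] -/
theorem Rtilde_kinAction (nbar : ℕ) (Y : Finset β) :
    Rtilde (fun t => ∑ y ∈ Y, kin κ B w U A φ ψ y t) nbar = ∑ y ∈ Y, Rtilde (kin κ B w U A φ ψ y) nbar :=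
  Rtilde_sum Y (fun y _ _ => contDiff_kin κ B w U A φ ψ y) nbar

/-- **The kinetic line of (5.6.13)**: `Σ_y κ|ψ(y) − (Q(ũ_{k+1}e^{iA})φ)(y)|² = Σ_y κ|ψ(y) − (Q(ũ_{k+1})φ)(y)|² + R̃_kin + Σ_□ W₁,kin(□)`
with `R̃_kin = R̃` of the total kinetic family (= `Σ_yR̃_y`, `Rtilde_kinAction`) and the last sum over the cubes met by the sites.
[cite: BalabanImbrieJaffe1988, (5.6.13) p.288] -/
theorem eq5613_kinetic (nbar : ℕ) (Y : Finset β) (cube : β → γ) :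
    ∑ y ∈ Y, kin κ B w U A φ ψ y 1
      = ∑ y ∈ Y, kin κ B w U A φ ψ y 0 + Rtilde (fun t => ∑ y ∈ Y, kin κ B w U A φ ψ y t) nbar
        + ∑ c ∈ Y.image cube, W1kinCube κ B w U A φ ψ nbar Y cube c := by
  unfold W1kinCube
  rw [Rtilde_kinAction, ← sum_eq_sum_cubeSum, ← Finset.sum_add_distrib, ← Finset.sum_add_distrib]
  exact Finset.sum_congr rfl fun y _ => eq5613_kin_site κ B w U A φ ψ nbar y

variable {B w U A φ ψ}

/-- kernel: `|W₁,kin(□)| ≤ |□|·b` from a uniform site bound `b` on `□`. [cite: BalabanImbrieJaffe1988, (5.6.13) p.288] -/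
theorem abs_W1kinCube_le (nbar : ℕ) (Y : Finset β) (cube : β → γ) (c : γ) {b : ℝ}
    (hb : ∀ y ∈ Y, cube y = c → |W1kin κ B w U A φ ψ nbar y| ≤ b) :
    |W1kinCube κ B w U A φ ψ nbar Y cube c| ≤ (Y.filter (fun y => cube y = c)).card * b := by
  have h := norm_cubeSum_le Y cube (W1kin κ B w U A φ ψ nbar) c (b := b) (fun y hy hc => by
    rw [Real.norm_eq_abs]; exact hb y hy hc)
  rwa [Real.norm_eq_abs] at h

end Cubes

/-! ## §6 Locality: `W₁,kin(□)` depends on the fields near `□` only -/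

section Locality

variable {σ : Type*} {γ : Type*} [DecidableEq γ]

/-- kernel: the site residual depends only on `ψ(y)` and on `φ`, `U(y,·)`, `A(y,·)` on the block `B(y)`.
[cite: BalabanImbrieJaffe1988, (5.6.13) p.288] -/
theorem resid_congr {B : β → Finset α} {w : ℝ} {U U' : β → α → ℂ} {A A' : β → α → ℝ} {φ φ' : α → ℂ} {ψ ψ' : β → ℂ}
    {y : β} (hψ : ψ y = ψ' y) (hφ : ∀ x ∈ B y, φ x = φ' x) (hU : ∀ x ∈ B y, U y x = U' y x)
    (hA : ∀ x ∈ B y, A y x = A' y x) :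
    resid B w U A φ ψ y = resid B w U' A' φ' ψ' y := by
  funext t
  rw [resid, resid, covAvg_twist_eq, covAvg_twist_eq, hψ]
  congr 1
  exact Finset.sum_congr rfl fun x hx => by rw [hφ x hx, hU x hx, hA x hx]

/-- **"W₁^{(k)}(□) is localized near □"** for the kinetic term: `W₁,kin(□)` is unchanged when `ψ` is changed off the sites of `□`
and `φ`, the transporters `U` and the contour sums `A` are changed off the blocks `B(y)`, `y ∈ □`.
[cite: BalabanImbrieJaffe1988, (5.6.13) p.288] -/
theorem W1kinCube_congr (κ : ℝ) {B : β → Finset α} {w : ℝ} {U U' : β → α → ℂ} {A A' : β → α → ℝ} {φ φ' : α → ℂ}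
    {ψ ψ' : β → ℂ} (nbar : ℕ) (Y : Finset β) (cube : β → γ) (c : γ)
    (hψ : ∀ y ∈ Y, cube y = c → ψ y = ψ' y) (hφ : ∀ y ∈ Y, cube y = c → ∀ x ∈ B y, φ x = φ' x)
    (hU : ∀ y ∈ Y, cube y = c → ∀ x ∈ B y, U y x = U' y x) (hA : ∀ y ∈ Y, cube y = c → ∀ x ∈ B y, A y x = A' y x) :
    W1kinCube κ B w U A φ ψ nbar Y cube c = W1kinCube κ B w U' A' φ' ψ' nbar Y cube c := by
  unfold W1kinCube
  refine cubeSum_congr Y cube fun y hy hc => ?_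
  unfold W1kin kin
  rw [resid_congr (hψ y hy hc) (hφ y hy hc) (hU y hy hc) (hA y hy hc)]

end Locality

/-! ## §7 The printed bound `|W₁^{(k)}(□)| ≦ e_k^{n̄−1−α}` for the kinetic term -/

section Scale

variable {σ : Type*} {γ : Type*} [DecidableEq γ]
variable {κ : ℝ} {B : β → Finset α} {w : ℝ} {U : β → α → ℂ} {A : β → α → ℝ} {φ : α → ℂ} {ψ : β → ℂ}

/-- The constant of the kinetic bound: `K = |κ|(2c_G)^{n̄+1}c_Φ(c_Ψ + c_Φ)/n̄!`. [cite: BalabanImbrieJaffe1988, (5.6.13) p.288] -/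
def kinConst (κ cG cΦ cΨ : ℝ) (nbar : ℕ) : ℝ := |κ| * (2 * cG) ^ (nbar + 1) * cΦ * (cΨ + cΦ) / nbar.factorial

/-- kernel: `K ≥ 0`. [cite: BalabanImbrieJaffe1988, (5.6.13) p.288] -/
theorem kinConst_nonneg {κ cG cΦ cΨ : ℝ} (hG : 0 ≤ cG) (hΦ : 0 ≤ cΦ) (hΨ : 0 ≤ cΨ) (nbar : ℕ) :
    0 ≤ kinConst κ cG cΦ cΨ nbar := by
  unfold kinConst; positivity

/-- The total power of `log e_k⁻¹` in the kinetic bound: `q = p(n̄+3) + rd` — `p(e_k)^{n̄+1}` from the derivatives, `p(e_k)²` from the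
two field factors, `r(e_k)^d` sites in a cube. [cite: BalabanImbrieJaffe1988, (5.6.13) p.288] -/
def kinLogPower (p r : ℝ) (d nbar : ℕ) : ℝ := p * (nbar + 3) + r * d

/-- **The kinetic site bound in print's currency**: with `G ≤ c_Ge·p(e)`, `eΦ ≤ c_Φp(e)`, `eΨ ≤ c_Ψp(e)` (`e = e_k`, `p(e) = p(e_k)` of
(2.33), `0 < e`), `|W₁,kin(y)| ≤ K·e^{n̄−1}·p(e)^{n̄+3}` — `n̄ + 1` powers of `e_k` from the derivatives, two spent on the field
bounds (*"Two powers of e_k may be needed to beat the bounds on φ"*). [cite: BalabanImbrieJaffe1988, (5.6.13) p.288] -/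
theorem abs_W1kin_le_scale {e p cG cΦ cΨ G Φ Ψ : ℝ} (he : 0 < e) (hcG : 0 ≤ cG) (hcΦ : 0 ≤ cΦ)
    (hG0 : 0 ≤ G) (hΦ0 : 0 ≤ Φ) (hG : G ≤ cG * e * pLog p e) (hΦ : e * Φ ≤ cΦ * pLog p e) (hΨ : e * Ψ ≤ cΨ * pLog p e)
    {y : β} (hU : ∀ x ∈ B y, ‖U y x‖ ≤ 1) (hA : ∀ x ∈ B y, |A y x| ≤ G) (hφ : ∀ x ∈ B y, ‖φ x‖ ≤ Φ) (hψ : ‖ψ y‖ ≤ Ψ)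
    (hw : |w| * (B y).card ≤ 1) (nbar : ℕ) :
    |W1kin κ B w U A φ ψ nbar y| ≤ kinConst κ cG cΦ cΨ nbar * e ^ ((nbar : ℝ) - 1) * pLog p e ^ (nbar + 3) := by
  have hP : 0 ≤ pLog p e := Real.rpow_nonneg (abs_nonneg _) _
  refine (abs_W1kin_le_of_fieldBounds κ hG0 hΦ0 hU hA hφ hψ hw nbar).trans ?_
  -- `Φ ≤ c_Φ p/e`, `Ψ + Φ ≤ (c_Ψ + c_Φ)p/e`, `2G ≤ 2c_G e p`
  have hΦ' : Φ ≤ cΦ * pLog p e / e := by rw [le_div_iff₀ he]; linarith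
  have hΨΦ : Ψ + Φ ≤ (cΨ + cΦ) * pLog p e / e := by rw [le_div_iff₀ he]; nlinarith
  have h2G : 2 * G ≤ 2 * cG * e * pLog p e := by nlinarith
  have hpow : (2 * G) ^ (nbar + 1) ≤ (2 * cG * e * pLog p e) ^ (nbar + 1) :=
    pow_le_pow_left₀ (by positivity) h2G _
  have hΨΦ0 : 0 ≤ Ψ + Φ := add_nonneg ((norm_nonneg _).trans hψ) hΦ0
  calc |κ| * ((2 * G) ^ (nbar + 1) * Φ * (Ψ + Φ)) / nbar.factorial
      ≤ |κ| * ((2 * cG * e * pLog p e) ^ (nbar + 1) * (cΦ * pLog p e / e) * ((cΨ + cΦ) * pLog p e / e)) / nbar.factorial := by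
        gcongr
    _ = kinConst κ cG cΦ cΨ nbar * (e ^ (nbar + 1) / e / e) * pLog p e ^ (nbar + 3) := by
        unfold kinConst; field_simp; ring
    _ = kinConst κ cG cΦ cΨ nbar * e ^ ((nbar : ℝ) - 1) * pLog p e ^ (nbar + 3) := by
        congr 2
        rw [div_div, ← pow_two, ← Real.rpow_natCast, ← Real.rpow_natCast, ← Real.rpow_sub he]
        push_cast; ring_nf

/-- **The kinetic cube bound in print's currency**: with moreover `|□| ≤ r(e)^d` sites per cube (`r(e) = r(e_k)` of (2.3)) and
`e ≤ e⁻¹` (so `log e⁻¹ ≥ 1`), `|W₁,kin(□)| ≤ K·e^{n̄−1}·(log e⁻¹)^{p(n̄+3)+rd}`.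
[cite: BalabanImbrieJaffe1988, (5.6.13) p.288] -/
theorem abs_W1kinCube_le_scale {e p r cG cΦ cΨ G Φ Ψ : ℝ} {d : ℕ} (he : 0 < e) (he1 : e ≤ Real.exp (-1))
    (hcG : 0 ≤ cG) (hcΦ : 0 ≤ cΦ) (hcΨ : 0 ≤ cΨ) (hG0 : 0 ≤ G) (hΦ0 : 0 ≤ Φ) (hG : G ≤ cG * e * pLog p e)
    (hΦ : e * Φ ≤ cΦ * pLog p e) (hΨ : e * Ψ ≤ cΨ * pLog p e) (Y : Finset β) (cube : β → γ) (c : γ)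
    (hU : ∀ y ∈ Y, ∀ x ∈ B y, ‖U y x‖ ≤ 1) (hA : ∀ y ∈ Y, ∀ x ∈ B y, |A y x| ≤ G) (hφ : ∀ y ∈ Y, ∀ x ∈ B y, ‖φ x‖ ≤ Φ)
    (hψ : ∀ y ∈ Y, ‖ψ y‖ ≤ Ψ) (hw : ∀ y ∈ Y, |w| * (B y).card ≤ 1)
    (hcard : ((Y.filter (fun y => cube y = c)).card : ℝ) ≤ rLen r e ^ d) (nbar : ℕ) :
    |W1kinCube κ B w U A φ ψ nbar Y cube c|
      ≤ kinConst κ cG cΦ cΨ nbar * e ^ ((nbar : ℝ) - 1) * Real.log e⁻¹ ^ kinLogPower p r d nbar := by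
  have he1' : e ≤ 1 := le_one_of_le_exp_neg_one he1
  have hK := kinConst_nonneg (κ := κ) hcG hcΦ hcΨ nbar
  have hsite : ∀ y ∈ Y, cube y = c →
      |W1kin κ B w U A φ ψ nbar y| ≤ kinConst κ cG cΦ cΨ nbar * e ^ ((nbar : ℝ) - 1) * pLog p e ^ (nbar + 3) :=
    fun y hy _ => abs_W1kin_le_scale he hcG hcΦ hG0 hΦ0 hG hΦ hΨ (hU y hy) (hA y hy) (hφ y hy) (hψ y hy) (hw y hy) nbar
  refine (abs_W1kinCube_le κ nbar Y cube c hsite).trans ?_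
  have hb : 0 ≤ kinConst κ cG cΦ cΨ nbar * e ^ ((nbar : ℝ) - 1) * pLog p e ^ (nbar + 3) :=
    mul_nonneg (mul_nonneg hK (Real.rpow_nonneg he.le _)) (pow_nonneg (Real.rpow_nonneg (abs_nonneg _) _) _)
  calc ((Y.filter (fun y => cube y = c)).card : ℝ) * (kinConst κ cG cΦ cΨ nbar * e ^ ((nbar : ℝ) - 1) * pLog p e ^ (nbar + 3))
      ≤ rLen r e ^ d * (kinConst κ cG cΦ cΨ nbar * e ^ ((nbar : ℝ) - 1) * pLog p e ^ (nbar + 3)) :=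
        mul_le_mul_of_nonneg_right hcard hb
    _ = kinConst κ cG cΦ cΨ nbar * e ^ ((nbar : ℝ) - 1) * (pLog p e ^ (nbar + 3) * rLen r e ^ d) := by ring
    _ = kinConst κ cG cΦ cΨ nbar * e ^ ((nbar : ℝ) - 1) * Real.log e⁻¹ ^ kinLogPower p r d nbar := by
        congr 1
        rw [pLog_eq_rpow he he1', rLen_eq_rpow he he1', log_rpow_pow he he1', log_rpow_pow he he1',
          log_rpow_mul_log_rpow he he1, kinLogPower]
        push_cast; ring_nf

/-- **`|W₁^{(k)}(□)| ≦ e_k^{n̄−1−α}` for the kinetic term** — r16's row leaf `BIJ88Sect5StatementsPart2.Ineq5613` INHABITED by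
`W₁ = W₁,kin(□)`: under the displayed hypotheses of `abs_W1kinCube_le_scale` at every cube and for every running charge
`0 < e_k ≤ min(e⁻¹, e₀)`, `e₀ = BIJ88Eq5613Summary.threshold K q α` explicit (`K = kinConst …`, `q = kinLogPower … > 0`, `α > 0`).
[cite: BalabanImbrieJaffe1988, (5.6.13) p.288] -/
theorem ineq5613_kinetic {γ : Type} [DecidableEq γ] {e p r cG cΦ cΨ G Φ Ψ α : ℝ} {d : ℕ} (he : 0 < e)
    (he1 : e ≤ Real.exp (-1)) (hcG : 0 ≤ cG) (hcΦ : 0 ≤ cΦ) (hcΨ : 0 ≤ cΨ) (hG0 : 0 ≤ G)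
    (hΦ0 : 0 ≤ Φ) (hG : G ≤ cG * e * pLog p e) (hΦ : e * Φ ≤ cΦ * pLog p e) (hΨ : e * Ψ ≤ cΨ * pLog p e) (Y : Finset β)
    (cube : β → γ) (hU : ∀ y ∈ Y, ∀ x ∈ B y, ‖U y x‖ ≤ 1) (hA : ∀ y ∈ Y, ∀ x ∈ B y, |A y x| ≤ G)
    (hφ : ∀ y ∈ Y, ∀ x ∈ B y, ‖φ x‖ ≤ Φ) (hψ : ∀ y ∈ Y, ‖ψ y‖ ≤ Ψ) (hw : ∀ y ∈ Y, |w| * (B y).card ≤ 1)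
    (hcard : ∀ c, ((Y.filter (fun y => cube y = c)).card : ℝ) ≤ rLen r e ^ d) (nbar : ℕ) (hα : 0 < α)
    (hq : 0 < kinLogPower p r d nbar) (hth : e ≤ threshold (kinConst κ cG cΦ cΨ nbar) (kinLogPower p r d nbar) α) :
    Ineq5613 γ (W1kinCube κ B w U A φ ψ nbar Y cube) e nbar α := by
  refine ineq5613_of_cube_bounds Y cube _ he nbar α fun c _ => ?_
  exact BIJ88Eq5613Summary.absorb_logs_nbar (kinConst_nonneg hcG hcΦ hcΨ nbar) hq hα he (le_one_of_le_exp_neg_one he1) hth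
    (abs_W1kinCube_le_scale he he1 hcG hcΦ hcΨ hG0 hΦ0 hG hΦ hΨ Y cube c hU hA hφ hψ hw (hcard c) nbar)

end Scale

/-! ## §8 The two other kinetic sources of `W₁`: phase factors and `w₁` terms -/

section Sources

/-- kernel: `| |a|² − |b|² | ≤ (‖a‖ + ‖b‖)‖a − b‖`. [cite: BalabanImbrieJaffe1988, (5.6.13) p.288] -/
theorem abs_normSq_sub_normSq_le (a b : ℂ) : |‖a‖ ^ 2 - ‖b‖ ^ 2| ≤ (‖a‖ + ‖b‖) * ‖a - b‖ := by
  rw [sq_sub_sq, abs_mul, abs_of_nonneg (add_nonneg (norm_nonneg a) (norm_nonneg b))]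
  exact mul_le_mul_of_nonneg_left (abs_norm_sub_norm_le a b) (add_nonneg (norm_nonneg a) (norm_nonneg b))

variable {B : β → Finset α} {w : ℝ} {U : β → α → ℂ} {φ : α → ℂ} {ψ : β → ℂ} {y : β}

/-- kernel: changing the fields by factors `P` with `|P − 1| ≤ δ` (the phase factors `e^{ie_k(w₂A′)}` of *"The tildes on φ and ψ"*)
moves the residual `ψ(y) − (Q(U)φ)(y)` by at most `δ(‖ψ(y)‖ + ρ₁(y))` (`|U| ≤ 1`). [cite: BalabanImbrieJaffe1988, (5.6.13) p.288] -/
theorem norm_resid_phase_sub_le {Pψ : β → ℂ} {Pφ : α → ℂ} {δ : ℝ} (hU : ∀ x ∈ B y, ‖U y x‖ ≤ 1)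
    (hPψ : ‖Pψ y - 1‖ ≤ δ) (hPφ : ∀ x ∈ B y, ‖Pφ x - 1‖ ≤ δ) :
    ‖(ψ y * Pψ y - covAvg B w U (fun x => φ x * Pφ x) y) - (ψ y - covAvg B w U φ y)‖ ≤ δ * (‖ψ y‖ + rho1 B w φ y) := by
  have hδ : 0 ≤ δ := (norm_nonneg _).trans hPψ
  have h1 : (ψ y * Pψ y - covAvg B w U (fun x => φ x * Pφ x) y) - (ψ y - covAvg B w U φ y)
      = ψ y * (Pψ y - 1) - ∑ x ∈ B y, (w : ℂ) * U y x * φ x * (Pφ x - 1) := by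
    have hs : ∑ x ∈ B y, (w : ℂ) * U y x * φ x * (Pφ x - 1)
        = covAvg B w U (fun x => φ x * Pφ x) y - covAvg B w U φ y := by
      unfold covAvg
      rw [← Finset.sum_sub_distrib]
      exact Finset.sum_congr rfl fun x _ => by ring
    rw [hs]; ring
  rw [h1]
  refine (norm_sub_le _ _).trans ?_
  rw [mul_add, rho1, norm_mul]
  refine add_le_add (by nlinarith [norm_nonneg (ψ y), norm_nonneg (Pψ y - 1)]) ?_
  rw [← mul_assoc, mul_comm δ, mul_assoc, Finset.mul_sum, Finset.mul_sum]
  refine (norm_sum_le _ _).trans (Finset.sum_le_sum fun x hx => ?_)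
  rw [norm_mul, norm_mul, norm_mul, Complex.norm_real, Real.norm_eq_abs]
  calc |w| * ‖U y x‖ * ‖φ x‖ * ‖Pφ x - 1‖ ≤ |w| * 1 * ‖φ x‖ * δ := by
        gcongr
        · exact hU x hx
        · exact hPφ x hx
    _ = |w| * (δ * ‖φ x‖) := by ring

/-- **The phase-factor source of `W₁` for the kinetic term** (*"We expand the phase factors as 1 + (e^{ie_kw₂A′} − 1), the second
term being extremely small"*): with `|P − 1| ≤ δ` on the factors of `ψ(y)` and of `φ` on `B(y)`,
`|κ|ψ̃(y) − (Q(U)φ̃)(y)|² − κ|ψ(y) − (Q(U)φ)(y)|²| ≤ |κ|·δ(2 + δ)·(‖ψ(y)‖ + ρ₁(y))²`; by (5.4.7) `δ = O(e_ke^{−cr(e_k)})`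
(p31 g10 `BIJ88Insertions288.norm_phase_sub_one_le`). [cite: BalabanImbrieJaffe1988, (5.6.13) p.288] -/
theorem abs_kin_phase_sub_le (κ : ℝ) {Pψ : β → ℂ} {Pφ : α → ℂ} {δ : ℝ} (hU : ∀ x ∈ B y, ‖U y x‖ ≤ 1)
    (hPψ : ‖Pψ y - 1‖ ≤ δ) (hPφ : ∀ x ∈ B y, ‖Pφ x - 1‖ ≤ δ) :
    |κ * ‖ψ y * Pψ y - covAvg B w U (fun x => φ x * Pφ x) y‖ ^ 2 - κ * ‖ψ y - covAvg B w U φ y‖ ^ 2|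
      ≤ |κ| * (δ * (2 + δ) * (‖ψ y‖ + rho1 B w φ y) ^ 2) := by
  have hδ : 0 ≤ δ := (norm_nonneg _).trans hPψ
  set a := ψ y * Pψ y - covAvg B w U (fun x => φ x * Pφ x) y
  set b := ψ y - covAvg B w U φ y
  have hab : ‖a - b‖ ≤ δ * (‖ψ y‖ + rho1 B w φ y) := norm_resid_phase_sub_le hU hPψ hPφ
  have hb : ‖b‖ ≤ ‖ψ y‖ + rho1 B w φ y := by
    have := norm_resid_le (A := fun _ _ => 0) (ψ := ψ) (w := w) (φ := φ) hU 0
    rwa [resid_zero_eq] at this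
  have ha : ‖a‖ ≤ (1 + δ) * (‖ψ y‖ + rho1 B w φ y) := by
    have : ‖a‖ ≤ ‖b‖ + ‖a - b‖ := by
      have := norm_add_le b (a - b); rwa [add_sub_cancel] at this
    nlinarith
  rw [← mul_sub, abs_mul]
  refine mul_le_mul_of_nonneg_left ?_ (abs_nonneg κ)
  refine (abs_normSq_sub_normSq_le a b).trans ?_
  have hρ : 0 ≤ ‖ψ y‖ + rho1 B w φ y := add_nonneg (norm_nonneg _) (rho1_nonneg B w φ y)
  calc (‖a‖ + ‖b‖) * ‖a - b‖ ≤ ((1 + δ) * (‖ψ y‖ + rho1 B w φ y) + (‖ψ y‖ + rho1 B w φ y)) * (δ * (‖ψ y‖ + rho1 B w φ y)) :=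
        mul_le_mul (add_le_add ha hb) hab (norm_nonneg _) (by positivity)
    _ = δ * (2 + δ) * (‖ψ y‖ + rho1 B w φ y) ^ 2 := by ring

variable {A : β → α → ℝ}

/-- kernel: extra transporter phases `e^{iA′(y,x)}` (the `w₁A′` part of `ũ` in (5.6.6), absent from the interpolation (5.6.14)) with
`|e^{iA′} − 1| ≤ δ′` on `B(y)` move the interpolated block average by at most `δ′ρ₁(y)` (`|U| ≤ 1`).
[cite: BalabanImbrieJaffe1988, (5.6.13) p.288] -/
theorem norm_covAvg_w1_sub_le {A' : β → α → ℝ} {δ' : ℝ} (hU : ∀ x ∈ B y, ‖U y x‖ ≤ 1)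
    (hA' : ∀ x ∈ B y, ‖ephase (A' y x) 1 - 1‖ ≤ δ') (t : ℝ) :
    ‖covAvg B w (twist (twist U A' 1) A t) φ y - covAvg B w (twist U A t) φ y‖ ≤ δ' * rho1 B w φ y := by
  rw [covAvg_twist_eq, covAvg_twist_eq, ← Finset.sum_sub_distrib, rho1, ← mul_assoc, mul_comm δ', mul_assoc, Finset.mul_sum,
    Finset.mul_sum]
  refine (norm_sum_le _ _).trans (Finset.sum_le_sum fun x hx => ?_)
  have h1 : (w : ℂ) * twist U A' 1 y x * φ x * ephase (A y x) t - (w : ℂ) * U y x * φ x * ephase (A y x) t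
      = (w : ℂ) * U y x * φ x * ephase (A y x) t * (ephase (A' y x) 1 - 1) := by
    simp only [twist]; ring
  rw [h1, norm_mul, norm_mul, norm_mul, norm_mul, norm_ephase, mul_one, Complex.norm_real, Real.norm_eq_abs]
  calc |w| * ‖U y x‖ * ‖φ x‖ * ‖ephase (A' y x) 1 - 1‖ ≤ |w| * 1 * ‖φ x‖ * δ' := by
        gcongr
        · exact hU x hx
        · exact hA' x hx
    _ = |w| * (δ' * ‖φ x‖) := by ring

/-- kernel: `|e^{ia′} − 1| ≤ |a′|` for real `a′` — the size `δ′` of one extra phase is the size of its exponent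
`e_kη(w₁A′)(Γ_{y,x}) = O(e_ke^{−cr(e_k)})` ((5.4.7)-type bound on `w₁`, p. 282). [cite: BalabanImbrieJaffe1988, (5.6.13) p.288] -/
theorem norm_ephase_one_sub_one_le (a : ℝ) : ‖ephase a 1 - 1‖ ≤ |a| := by
  rw [ephase, one_mul, mul_comm, ← Real.norm_eq_abs]
  exact Real.norm_exp_I_mul_ofReal_sub_one_le

/-- **The `w₁` source of `W₁` for the kinetic term** (*"Any term involving w₁ or w₂ … will be treated separately"*): the kinetic
density at the actual field `ũ_{k+1}ũ`, `ũ = e^{ie_kη[θ_kH_{k,loc}A^{(k)} + w₁A′]}` (transporters `Ue^{iA′}e^{iA}`), minus the `e′ = 1`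
member of the interpolation (transporters `Ue^{iA}`) is at most `|κ|·δ′ρ₁(2ρ₀ + δ′ρ₁)` for `|e^{iA′} − 1| ≤ δ′`.
[cite: BalabanImbrieJaffe1988, (5.6.13) p.288] -/
theorem abs_kin_w1_sub_le (κ : ℝ) {A' : β → α → ℝ} {δ' : ℝ} (hδ' : 0 ≤ δ') (hU : ∀ x ∈ B y, ‖U y x‖ ≤ 1)
    (hA' : ∀ x ∈ B y, ‖ephase (A' y x) 1 - 1‖ ≤ δ') :
    |kin κ B w (twist U A' 1) A φ ψ y 1 - kin κ B w U A φ ψ y 1|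
      ≤ |κ| * (δ' * rho1 B w φ y * (2 * (‖ψ y‖ + rho1 B w φ y) + δ' * rho1 B w φ y)) := by
  unfold kin
  set a := resid B w (twist U A' 1) A φ ψ y 1 with ha_def
  set b := resid B w U A φ ψ y 1 with hb_def
  have hρ1 := rho1_nonneg B w φ y
  have hρ : 0 ≤ ‖ψ y‖ + rho1 B w φ y := add_nonneg (norm_nonneg _) hρ1
  have hab : ‖a - b‖ ≤ δ' * rho1 B w φ y := by
    have h := norm_covAvg_w1_sub_le (w := w) (φ := φ) (A := A) hU hA' 1
    have : a - b = -(covAvg B w (twist (twist U A' 1) A 1) φ y - covAvg B w (twist U A 1) φ y) := by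
      rw [ha_def, hb_def, resid, resid]; ring
    rw [this, norm_neg]; exact h
  have hb : ‖b‖ ≤ ‖ψ y‖ + rho1 B w φ y := norm_resid_le hU 1
  have ha : ‖a‖ ≤ ‖ψ y‖ + rho1 B w φ y + δ' * rho1 B w φ y := by
    have : ‖a‖ ≤ ‖b‖ + ‖a - b‖ := by
      have := norm_add_le b (a - b); rwa [add_sub_cancel] at this
    linarith
  rw [← mul_sub, abs_mul]
  refine mul_le_mul_of_nonneg_left ((abs_normSq_sub_normSq_le a b).trans ?_) (abs_nonneg κ)
  calc (‖a‖ + ‖b‖) * ‖a - b‖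
      ≤ ((‖ψ y‖ + rho1 B w φ y + δ' * rho1 B w φ y) + (‖ψ y‖ + rho1 B w φ y)) * (δ' * rho1 B w φ y) :=
        mul_le_mul (add_le_add ha hb) hab (norm_nonneg _) (by positivity)
    _ = δ' * rho1 B w φ y * (2 * (‖ψ y‖ + rho1 B w φ y) + δ' * rho1 B w φ y) := by ring

end Sources

end Literature.MathematicalPhysics.QuantumFieldTheory.BalabanImbrieJaffe1984to88.BIJ88Eq5613Kinetic

end
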